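import Summits.BirchSwinnertonDyer.Rank1Residual.GaloisImage.SakamotoN11Instance
import Literature.NumberTheory.EllipticCurves.KuriharaNumberKimCertificate
import Literature.NumberTheory.EllipticCurves.KummerSelmerStructure
import Literature.NumberTheory.EllipticCurves.Rank1Residual.Predicates
import HarnessLib

/-!
# DICT3 @ 3 — the Kato–Kurihara dictionary at an additive prime `3`, TYPED as a PORT statement
# (C.-H. Kim, AJM 148 (2026) = arXiv:2203.12159, Thm. 3.13, printed for `p ≥ 5`; cell `b2b-bsdres`,
# team n1011, ROUTE-1 sub-target R1-21, seat p09 GEN 3; consumer = R1-23's (a′) assembly)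

HONEST FRAMING (run/shared/lean/b2b/bsd-rank1-residual/, verbatim in every file): the goal of the
cell is to DELETE the COMBINATION-SHAPED residual classes of the Birch–Swinnerton-Dyer formula for
ALL analytic-rank `≤ 1` elliptic curves over `ℚ` — "full BSD formula for every rank `≤ 1` curve in
class `C`" assembled STRICTLY from published theorems — so that the rank-`≤ 1` remainder becomes
exactly the CONSTRUCTION-SHAPED classes, which are TYPED (missing-input `Prop`s), NOT attempted.
This is not "finishing BSD".  Team n1011 (N10/N11, the additive `p = 3` block) is a RESEARCH ROUTE;
no claim beyond the stated classes; the label X4 and the mark of RESIDUAL-MAP §I N11 are UNCHANGED;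
nothing is booked.  THIS FILE TYPES A STATEMENT, IT PROVES NOTHING: `KatoKuriharaDictionaryThreeAt` is a
`Prop`-valued PREDICATE (a missing-input / PORT statement) to be taken as an explicit hypothesis by its
consumer (R1-23); it is NOT a Literature fact (the printed theorem is `p ≥ 5`; at `p = 3` it is NOT IN
PRINT), it carries no `_holds`, and asserting it for a curve is a DEBT of whoever assumes it.
FLAG `K22-Thm3.13-PORT@3`.

## The printed statement and what is ported

[K22] = C.-H. Kim, *The structure of Selmer groups and the Iwasawa main conjecture for elliptic
curves*, Amer. J. Math. 148 (2026) = arXiv:2203.12159 (the tree cites §3 items by the arXiv numbering,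
cf. `KuriharaNumberKimStructure`'s NUMBERING NOTE).  **Thm. 3.13** (arXiv p. 17, L130–136, verbatim):
"Let `E` be an elliptic curve over `ℚ` and `p ≥ 5` is a prime such that `ρ̄` is surjective and the Manin
constant is prime to `p`.  Then we have formula `ι ∘ exp*_{ω_E} ∘ loc^s_p(κ̃^{Kato}_n) = u · p^t · δ̃_n ∈
ℤ_p/I_nℤ_p` where `u ∈ (ℤ_p/I_nℤ_p)^×`."  Here (§3.4.1, p. 17 L119–127) `n ∈ 𝒩₁`,
`κ̃^{Kato}_n ∈ Sel_{rel,n}(ℚ, T/I_nT)` is the mod-`I_n` KOLYVAGIN DERIVATIVE `D_{ℚ(μ_n)} z^{Kato}_{ℚ(μ_n)}`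
of Kato's zeta element (proof, p. 18 L1–60: "comes from the mod `I_n` reduction of
`D_{ℚ(μ_n)} z^{Kato}_{ℚ(μ_n)}`"), `exp*_{ω_E}` is the dual exponential map EXTENDED TO TORSION
COEFFICIENTS (§3.3: for `E(ℚ_p)[p^∞] ≠ 0` through the splitting of Prop. 3.12), `ι` is the FIXED
isomorphism `#Ẽ_ns(𝔽_p)p^{1+t}ℤ_p/(…)I_n ≅ ℤ_p/I_n` with `#Ẽ_ns(𝔽_p) = p` at an additive `p`,
`p^t = #E(ℚ_p)[p^∞]`, `δ̃_n` = Kim's Kurihara number (§1.4.3; the tree's `kuriharaNumber`, Néron period,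
discrete logarithms `ψ_ℓ = log_{η_ℓ}`), and the Euler-type factor `E_p` of the proof equals `1` when
`p² ∣ N` (additive reduction; p. 18 L9–13).  The unit `u` depends on `n` only through the fixed choices
(Kato's `γ`, the generators `η_ℓ`, i.e. `ψ`), not on `E`'s arithmetic.
The ONLY `p ≥ 5` ingredient is Rem. 3.8 ("`p ∤ [E(ℚ_p):E₀(ℚ_p)]`"), which at `p = 3` READS `3 ∤ c₃`
(ROUTE-1 §20.3; at `c₃ = 3` the exponent changes, §17 F-b) — hence the hypothesis `hc3` below; the
surjectivity of `ρ̄_{E,3}` and the Manin / period binders are carried exactly as in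
`Kim2022_kuriharaNumber_certificate`.

## The typed shape (ROUTE-1 §21.2.4 / §21.7, r1 GEN 9; p09's scoping line and r1's blocking correction)

For `W/ℚ` globally minimal, a depth `k` (everything mod `3^{k+1}` on `T/3^{k+1} = E[3^{k+1}]` =
`geomTorsion W (3^k·3)`, Kolyvagin levels `d ⊆ 𝒫` of the instance's KOLYVAGIN DATUM `D` — p13's
`SakamotoN11Instance`, Sakamoto's `τ`-primes of level `3^{k+1}`, so `I_d ⊇ 3^{k+1}ℤ₃` and the finer
Kim–Pollack `I_n` is dropped, r1 §21.7 (Qb)), the exponent `t` of `#E(ℚ₃)[3] = 3^t` (explicit binder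
`ht`; `= #E(ℚ₃)[3^∞]` on `Addv ∧ 3 ∤ c₃` rows, p05 T-R1-24), a finite place `v₃ ∣ 3`, and a modular
parametrisation datum `P` with `3 ∤ c_P` and the period transfer, the predicate asserts the EXISTENCE of
* a BARE family `κ : d ↦ κ_d ∈ H¹(ℚ, E[3^{k+1}])` with `κ_d ∈ H¹_{𝓕_can(d)}` (`𝓕_can` = p13's
  `propagatedSelmerStructure W 3 k`, transverse at `d`) — Kato's DERIVATIVE classes (r1 §21.7 (Qa):
  not asserted to be an element of the tree's generator-fixed `kolyvaginSystems`);
* the (I4) BRIDGE: a genuine Kolyvagin system `κ′ ∈ KS₁(E[3^{k+1}], 𝓕_can, 𝒫)` with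
  `κ′_d − κ_d ∈ ℤ-span{κ_c : c ⊊ d}` (UNITRIANGULAR; [MR04] Thm. 3.2.4 + App. A eq. (33), `p`-free);
* a `ℤ/3^{k+1}`-linear functional `Λ` on `H¹(ℚ₃, E[3^{k+1}])` ('`ι ∘ 3^t · exp*_ω`', typed on the whole
  local group as any extension) which ON `𝓕_can(v₃) = im(H¹(ℚ₃,T₃E) → H¹(ℚ₃,E[3^{k+1}]))` is onto
  `ℤ/3^{k+1}` with kernel the KUMMER part `W.kummerSelmerStructure (3^k·3) v₃` (r1's correction:
  `𝓕_can(v₃) ⊋` Kummer part, quotient `H¹_s(ℚ₃,T)/3^{k+1} ≅ ℤ/3^{k+1}`, [K22] Prop. 3.12 shape),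
such that for EVERY level `d` (the empty level included — there the clause is Kato's explicit
reciprocity law Thm. 12.5 (1) in `Λ`-currency, `δ̃_1 = [0]⁺ = L(E,1)/Ω`):
`Λ(loc_{v₃} κ_d) = u_d · 3^t · δ̃_{n(d)}`, `n(d) = ∏_{q ∈ d} Nq`, `u_d` a unit, for some surjective
discrete logarithms `ψ` (a change of `ψ` changes `δ̃` by a unit, `exists_units_kuriharaNumber_eq_mul`).

What is NOT here: any proof or instance (`_holds`); the verification that p13's `D` carries
Sakamoto's primes / transverse conditions (the consumer's binders `hP`/`hT`/`hD`); the `c₃ = 3` variant.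

References: [Kim2022StructureSelmer] §1.4.3, §3.3 (Lemma 3.11, Prop. 3.12), §3.4.1, Thm. 3.13 and its
proof (arXiv pp. 17–18); [Kato2004Asterisque] Thm. 12.5 (1); [MazurRubin2004] Thm. 3.2.4, App. A (33);
[Sakamoto2024] Def. 4.1, Thm. 4.4; cells/n1011/ROUTE-1.md §20.2–20.3, §21.2.4, §21.7 (r1 GEN 8/9);
n1011-lit GEN 4 locator check (INBOX 2026-08-21T09:40Z); seat NOTES.md (n1011-p09 GEN 3).
-/

noncomputable section

open scoped Classical NumberField
open NumberField IsDedekindDomain WeierstrassCurve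
  Literature.NumberTheory.EllipticCurves Literature.NumberTheory.EllipticCurves.ModularForms
  Literature.NumberTheory.EllipticCurves.Rank1Residual
  Literature.NumberTheory.GaloisRepresentations
  Literature.NumberTheory.GaloisRepresentations.DiscreteGaloisModule Literature.NumberTheory.GaloisCohomology

namespace Summit.BirchSwinnertonDyer.Rank1Residual.GaloisImage

/-- **DICT3 @ 3 (PORT of [K22] Thm. 3.13 to the additive prime `3`; FLAG `K22-Thm3.13-PORT@3`; NOT in
print at `3` — a missing-input predicate, to be ASSUMED by its consumer, never `_holds` here).**
For `W/ℚ` globally minimal with ADDITIVE reduction at `3`, `3 ∤ c₃`, `ρ̄_{E,3}` onto, a depth `k`, the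
`3`-torsion exponent `t` (`#E(ℚ₃)[3] = 3^t`), a Kolyvagin datum `D` on `E[3^{k+1}]`, a place `v₃ ∣ 3`:
for every modular parametrisation datum `P` with `3 ∤ c_P` and the period transfer
`Ω(W) = u·Ω⁺_{P.f}`, `|u|₃ = 1`, there exist Kato's derivative family `κ` (with `κ_d ∈ H¹_{𝓕_can(d)}`),
a Kolyvagin system `κ′ ∈ KS₁(E[3^{k+1}], 𝓕_can, 𝒫)` unitriangularly congruent to it, and the
dual-exponential functional `Λ = ι∘3^t·exp*_ω` (onto `ℤ/3^{k+1}` on `𝓕_can(v₃)` with kernel the Kummer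
part), such that `Λ(loc_{v₃} κ_d) = u_d · 3^t · δ̃_{n(d)}` at every level `d ⊆ 𝒫` (module docstring).
[cite: Kim2022StructureSelmer, Thm. 3.13 and §3.3–§3.4.1 (arXiv pp. 17–18)]
[cite: Kato2004Asterisque, Thm. 12.5 (1)] [cite: MazurRubin2004, Thm. 3.2.4 and App. A (33)] -/
def KatoKuriharaDictionaryThreeAt (W : WeierstrassCurve ℚ) [W.IsElliptic] [W.IsGloballyMinimal]
    (k t : ℕ) (D : KolyvaginDatum (W.torsionGaloisModule (((3 : ℕ) : ℤ) ^ k * ((3 : ℕ) : ℤ))))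
    (v₃ : HeightOneSpectrum (𝓞 ℚ)) : Prop :=
  haveI : Fact (Nat.Prime 3) := ⟨Nat.prime_three⟩
  Addv W 3 → ¬ 3 ∣ (W.baseChange ℚ_[3]).localTamagawaNumber ℤ_[3] →
  W.HasSurjectiveModNGaloisRep ((3 : ℕ) : ℤ) →
  Nat.card {Q : (W.baseChange ℚ_[3]).toAffine.Point // (3 : ℕ) • Q = 0} = 3 ^ t →
  ((3 : ℕ) : 𝓞 ℚ) ∈ v₃.asIdeal →
  ∀ {N : ℕ} [NeZero N] (P : ModularParametrizationData W N),
    ¬ ((3 : ℕ) : ℤ) ∣ P.maninConstant →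
    (∃ u : ℚ, ‖(u : ℚ_[3])‖ = 1 ∧ W.realPeriodRat = u * plusPeriod P.f) →
    ∃ (κ : Finset (HeightOneSpectrum (𝓞 ℚ)) →
          galoisCohomology (W.torsionGaloisModule (((3 : ℕ) : ℤ) ^ k * ((3 : ℕ) : ℤ))) 1)
      (Λ : galoisCohomology ((W.torsionGaloisModule (((3 : ℕ) : ℤ) ^ k * ((3 : ℕ) : ℤ))).toLocal
              (Sum.inr v₃)) 1 →+ ZMod (3 ^ (k + 1))),
      -- (0) Kato's derivative classes live in the level-`d` propagated Selmer groups
      (∀ d, D.IsLevel d → κ d ∈ (D.atLevel (propagatedSelmerStructure W 3 k) d).selmerGroup) ∧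
      -- (I4) the Mazur–Rubin bridge: a genuine Kolyvagin system, unitriangularly congruent to `κ`
      (∃ κ' : D.kolyvaginSystems (propagatedSelmerStructure W 3 k), ∀ d, D.IsLevel d →
          κ'.1 d - κ d ∈ AddSubgroup.closure {x | ∃ c, c ⊂ d ∧ x = κ c}) ∧
      -- (Λ) `ι ∘ 3^t · exp*_ω` on `𝓕_can(v₃)`: onto `ℤ/3^{k+1}`, kernel = the Kummer part
      (∀ r : ZMod (3 ^ (k + 1)), ∃ x ∈ propagatedSelmerStructure W 3 k (Sum.inr v₃), Λ x = r) ∧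
      (∀ x ∈ propagatedSelmerStructure W 3 k (Sum.inr v₃),
          Λ x = 0 ↔ x ∈ W.kummerSelmerStructure (((3 : ℕ) : ℤ) ^ k * ((3 : ℕ) : ℤ)) (Sum.inr v₃)) ∧
      -- (DICT3) the dictionary at every level (`d = ∅`: Kato's Thm. 12.5 (1) in `Λ`-currency)
      ∀ (d : Finset (HeightOneSpectrum (𝓞 ℚ))), D.IsLevel d →
        ∃ (u : (ZMod (3 ^ (k + 1)))ˣ)
          (ψ : (ℓ : ℕ) → (ZMod ℓ)ˣ →* Multiplicative (ZMod (3 ^ (k + 1)))),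
          (∀ q ∈ d, Function.Surjective (ψ (Ideal.absNorm q.asIdeal))) ∧
          haveI : NeZero (∏ q ∈ d, Ideal.absNorm q.asIdeal) :=
            ⟨Finset.prod_ne_zero_iff.2 fun q _ h => q.ne_bot (Ideal.absNorm_eq_zero_iff.1 h)⟩
          Λ (galoisCohomology.localization _ (Sum.inr v₃) 1 (κ d)) =
            (u : ZMod (3 ^ (k + 1))) * (3 : ZMod (3 ^ (k + 1))) ^ t *
              kuriharaNumber P.f (3 ^ (k + 1)) (∏ q ∈ d, Ideal.absNorm q.asIdeal) ψ


/-! ### Two-level form (R1-23 input M1): the witness clauses with `κ′` exposed, the two-level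
predicate with the reduction compatibility of Kato's ONE Euler system, and the refinement lemma -/

open scoped ContRepresentation
/-- **The witness clauses of DICT3 @ 3 at ONE depth `k`, with the Kolyvagin system `κ′` of the (I4)
bridge EXPOSED** (same four clauses as `KatoKuriharaDictionaryThreeAt`: (0) `κ_d ∈ H¹_{𝓕_can(d)}`,
(I4) `κ′_d − κ_d ∈ ℤ-span{κ_c : c ⊊ d}`, (Λ) onto `ℤ/3^{k+1}` on `𝓕_can(v₃)` with kernel the Kummer
part, (DICT3) `Λ(loc_{v₃} κ_d) = u_d · 3^t · δ̃_{n(d)}`), for a fixed parametrisation datum `P`.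
[cite: Kim2022StructureSelmer, Thm. 3.13 and §3.3–§3.4.1 (arXiv pp. 17–18)]
[cite: MazurRubin2004, Thm. 3.2.4 and App. A (33)] -/
def KatoKuriharaWitnessAt (W : WeierstrassCurve ℚ) [W.IsElliptic] [W.IsGloballyMinimal]
    (k t : ℕ) (D : KolyvaginDatum (W.torsionGaloisModule (((3 : ℕ) : ℤ) ^ k * ((3 : ℕ) : ℤ))))
    (v₃ : HeightOneSpectrum (𝓞 ℚ)) {N : ℕ} [NeZero N] (P : ModularParametrizationData W N)
    (κ : Finset (HeightOneSpectrum (𝓞 ℚ)) →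
      galoisCohomology (W.torsionGaloisModule (((3 : ℕ) : ℤ) ^ k * ((3 : ℕ) : ℤ))) 1)
    (Λ : galoisCohomology ((W.torsionGaloisModule (((3 : ℕ) : ℤ) ^ k * ((3 : ℕ) : ℤ))).toLocal
      (Sum.inr v₃)) 1 →+ ZMod (3 ^ (k + 1)))
    (κ' : Finset (HeightOneSpectrum (𝓞 ℚ)) →
      galoisCohomology (W.torsionGaloisModule (((3 : ℕ) : ℤ) ^ k * ((3 : ℕ) : ℤ))) 1) : Prop :=
  haveI : Fact (Nat.Prime 3) := ⟨Nat.prime_three⟩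
  -- (0)
  (∀ d, D.IsLevel d → κ d ∈ (D.atLevel (propagatedSelmerStructure W 3 k) d).selmerGroup) ∧
  -- (I4), with the Kolyvagin system `κ′` exposed
  (κ' ∈ D.kolyvaginSystems (propagatedSelmerStructure W 3 k) ∧ ∀ d, D.IsLevel d →
      κ' d - κ d ∈ AddSubgroup.closure {x | ∃ c, c ⊂ d ∧ x = κ c}) ∧
  -- (Λ)
  (∀ r : ZMod (3 ^ (k + 1)), ∃ x ∈ propagatedSelmerStructure W 3 k (Sum.inr v₃), Λ x = r) ∧
  (∀ x ∈ propagatedSelmerStructure W 3 k (Sum.inr v₃),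
      Λ x = 0 ↔ x ∈ W.kummerSelmerStructure (((3 : ℕ) : ℤ) ^ k * ((3 : ℕ) : ℤ)) (Sum.inr v₃)) ∧
  -- (DICT3)
  ∀ (d : Finset (HeightOneSpectrum (𝓞 ℚ))), D.IsLevel d →
    ∃ (u : (ZMod (3 ^ (k + 1)))ˣ)
      (ψ : (ℓ : ℕ) → (ZMod ℓ)ˣ →* Multiplicative (ZMod (3 ^ (k + 1)))),
      (∀ q ∈ d, Function.Surjective (ψ (Ideal.absNorm q.asIdeal))) ∧
      haveI : NeZero (∏ q ∈ d, Ideal.absNorm q.asIdeal) :=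
        ⟨Finset.prod_ne_zero_iff.2 fun q _ h => q.ne_bot (Ideal.absNorm_eq_zero_iff.1 h)⟩
      Λ (galoisCohomology.localization _ (Sum.inr v₃) 1 (κ d)) =
        (u : ZMod (3 ^ (k + 1))) * (3 : ZMod (3 ^ (k + 1))) ^ t *
          kuriharaNumber P.f (3 ^ (k + 1)) (∏ q ∈ d, Ideal.absNorm q.asIdeal) ψ

/-- **DICT3 @ 3, TWO-LEVEL form (PORT; FLAG `K22-Thm3.13-PORT@3`; the input M1 of R1-23's (a′)
assembly, skeleton `cells/n1011/skel/T-R1-23.md` §3).**  Same hypotheses as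
`KatoKuriharaDictionaryThreeAt`; for two depths `k ≤ k′` and THE reduction map
`red : E[3^{k′+1}] ↠ E[3^{k+1}]`, `x ↦ 3^{k′−k}·x` (a binder, PINNED on geometric points by `hred`),
it asserts witnesses `(κ, Λ, κ′)` at depth `k` (for the datum `D`) and `(κ⁺, Λ⁺, κ′⁺)` at depth `k′`
(for `D′`) satisfying the single-level clauses, AND the REDUCTION COMPATIBILITY of Kato's families on
the common levels: `red_*(κ⁺_d) = κ_d` and `red_*(κ′⁺_d) = κ′_d` for every `d` that is a level of both
data — ONE Euler system: the derivative classes `D_n z^{Kato}_{ℚ(μ_n)} mod I_n` and their Mazur–Rubin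
corrections (33) at depth `k′` reduce to those at depth `k` ([MR04] Def. 3.1.3 / App. A (33); [K22]
§2.2.2).  NOT in print at `3` beyond what `KatoKuriharaDictionaryThreeAt` already is not; nothing
asserted; a DEBT of whoever assumes it.  (Locator rider, n1011-lit GEN 5: a UNIFORM-CONSTANT form of the
dictionary at every `p ≥ 3` and any reduction type is stated in the PREPRINT C.-H. Kim (app. R. Pollack),
arXiv:2505.09121v1 §4.2 — PRE, flag `Kim2025-preprint`; not used here.)  Two-level text drafted by n1011-p18
GEN 4 (R1-23 consumer, `HOME/b2b-bsdres-n1011-p18/r123/Dict2Draft.lean`), appended by the row owner.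
[cite: Kim2022StructureSelmer, Thm. 3.13 and §2.2.2, §3.3–§3.4.1 (arXiv pp. 12, 17–18)]
[cite: MazurRubin2004, Def. 3.1.3, Thm. 3.2.4 and App. A (33)] [cite: Kato2004Asterisque, Thm. 12.5 (1)] -/
def KatoKuriharaDictionaryThreeAt₂ (W : WeierstrassCurve ℚ) [W.IsElliptic] [W.IsGloballyMinimal]
    (t k k' : ℕ)
    (D : KolyvaginDatum (W.torsionGaloisModule (((3 : ℕ) : ℤ) ^ k * ((3 : ℕ) : ℤ))))
    (D' : KolyvaginDatum (W.torsionGaloisModule (((3 : ℕ) : ℤ) ^ k' * ((3 : ℕ) : ℤ))))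
    (red : (W.torsionGaloisModule (((3 : ℕ) : ℤ) ^ k' * ((3 : ℕ) : ℤ))).toContRepresentation →ⁱL
      (W.torsionGaloisModule (((3 : ℕ) : ℤ) ^ k * ((3 : ℕ) : ℤ))).toContRepresentation)
    (v₃ : HeightOneSpectrum (𝓞 ℚ)) : Prop :=
  haveI : Fact (Nat.Prime 3) := ⟨Nat.prime_three⟩
  k ≤ k' →
  -- `red` IS the reduction `x ↦ 3^{k′−k} x` (pinned on the underlying geometric points)
  (∀ x : geomTorsion W (((3 : ℕ) : ℤ) ^ k' * ((3 : ℕ) : ℤ)),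
      ((red x : geomTorsion W (((3 : ℕ) : ℤ) ^ k * ((3 : ℕ) : ℤ))) : geomPoints W) =
        (((3 : ℕ) : ℤ) ^ (k' - k)) • (x : geomPoints W)) →
  Addv W 3 → ¬ 3 ∣ (W.baseChange ℚ_[3]).localTamagawaNumber ℤ_[3] →
  W.HasSurjectiveModNGaloisRep ((3 : ℕ) : ℤ) →
  Nat.card {Q : (W.baseChange ℚ_[3]).toAffine.Point // (3 : ℕ) • Q = 0} = 3 ^ t →
  ((3 : ℕ) : 𝓞 ℚ) ∈ v₃.asIdeal →
  ∀ {N : ℕ} [NeZero N] (P : ModularParametrizationData W N),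
    ¬ ((3 : ℕ) : ℤ) ∣ P.maninConstant →
    (∃ u : ℚ, ‖(u : ℚ_[3])‖ = 1 ∧ W.realPeriodRat = u * plusPeriod P.f) →
    ∃ (κ : Finset (HeightOneSpectrum (𝓞 ℚ)) →
          galoisCohomology (W.torsionGaloisModule (((3 : ℕ) : ℤ) ^ k * ((3 : ℕ) : ℤ))) 1)
      (Λ : galoisCohomology ((W.torsionGaloisModule (((3 : ℕ) : ℤ) ^ k * ((3 : ℕ) : ℤ))).toLocal
          (Sum.inr v₃)) 1 →+ ZMod (3 ^ (k + 1)))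
      (κ' : Finset (HeightOneSpectrum (𝓞 ℚ)) →
          galoisCohomology (W.torsionGaloisModule (((3 : ℕ) : ℤ) ^ k * ((3 : ℕ) : ℤ))) 1)
      (κu : Finset (HeightOneSpectrum (𝓞 ℚ)) →
          galoisCohomology (W.torsionGaloisModule (((3 : ℕ) : ℤ) ^ k' * ((3 : ℕ) : ℤ))) 1)
      (Λu : galoisCohomology ((W.torsionGaloisModule (((3 : ℕ) : ℤ) ^ k' * ((3 : ℕ) : ℤ))).toLocal
          (Sum.inr v₃)) 1 →+ ZMod (3 ^ (k' + 1)))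
      (κu' : Finset (HeightOneSpectrum (𝓞 ℚ)) →
          galoisCohomology (W.torsionGaloisModule (((3 : ℕ) : ℤ) ^ k' * ((3 : ℕ) : ℤ))) 1),
      KatoKuriharaWitnessAt W k t D v₃ P κ Λ κ' ∧
      KatoKuriharaWitnessAt W k' t D' v₃ P κu Λu κu' ∧
      -- (COMP) one Euler system: the depth-`k′` families reduce to the depth-`k` families
      ∀ d, D'.IsLevel d → D.IsLevel d →
        galoisCohomology.map red 1 (κu d) = κ d ∧ galoisCohomology.map red 1 (κu' d) = κ' d

/-- The two-level form REFINES the landed single-level predicate at the lower depth.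
[cite: Kim2022StructureSelmer, Thm. 3.13 (arXiv p. 17)] -/
theorem katoKuriharaDictionaryThreeAt_of_two {W : WeierstrassCurve ℚ} [W.IsElliptic]
    [W.IsGloballyMinimal] {t k k' : ℕ}
    {D : KolyvaginDatum (W.torsionGaloisModule (((3 : ℕ) : ℤ) ^ k * ((3 : ℕ) : ℤ)))}
    {D' : KolyvaginDatum (W.torsionGaloisModule (((3 : ℕ) : ℤ) ^ k' * ((3 : ℕ) : ℤ)))}
    {red : (W.torsionGaloisModule (((3 : ℕ) : ℤ) ^ k' * ((3 : ℕ) : ℤ))).toContRepresentation →ⁱL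
      (W.torsionGaloisModule (((3 : ℕ) : ℤ) ^ k * ((3 : ℕ) : ℤ))).toContRepresentation}
    {v₃ : HeightOneSpectrum (𝓞 ℚ)} (h : KatoKuriharaDictionaryThreeAt₂ W t k k' D D' red v₃)
    (hk : k ≤ k')
    (hred : ∀ x : geomTorsion W (((3 : ℕ) : ℤ) ^ k' * ((3 : ℕ) : ℤ)),
      ((red x : geomTorsion W (((3 : ℕ) : ℤ) ^ k * ((3 : ℕ) : ℤ))) : geomPoints W) =
        (((3 : ℕ) : ℤ) ^ (k' - k)) • (x : geomPoints W)) :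
    KatoKuriharaDictionaryThreeAt W k t D v₃ := by
  intro hadd hc3 hsurj ht hv N _ P hc hper
  obtain ⟨κ, Λ, κ', -, -, -, hW, -, -⟩ := h hk hred hadd hc3 hsurj ht hv P hc hper
  obtain ⟨h0, ⟨hKS, hbr⟩, hon, hker, hdict⟩ := hW
  exact ⟨κ, Λ, h0, ⟨⟨κ', hKS⟩, hbr⟩, hon, hker, hdict⟩

/-! ### Cross-references appended by the row owner (n1011-p09 GEN 4, 2026-08-21; DOC-ONLY — no
declaration above is changed; r1 R1-38, r1 GEN 14 riders (R-a)/(R-d), ROUTE-1 §26.2 D10, bridge (B1))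

**(R1-38) Provenance of clause (0) at the places `q ∈ d`, and of `κ′ = κ` at core vertices.**  Clause
(0) puts the DERIVATIVE class `κ_d` in `𝓕_can(d)`, i.e. TRANSVERSE at `q ∈ d`, although Mazur–Rubin
(Mem. AMS 799 (2004), p. 80, L13–15) warn that the raw derivative classes are not in general a
Kolyvagin system and correct them by App. A (33).  For `T = T₃E` (indeed any rank-2 `T` with
`det T = ℤ_p(1)`) the correction VANISHES: by [MR04] Thm. A.4 (p. 80) the defect `(κ_n)_{ℓ,f}` is a sum
of terms carrying factors `ρ_q(P_q(Fr⁻¹))`, `ρ_q : A_{q,I}/A²_{q,I} → G_q ⊗ R/I` (Def. A.3), and for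
`q ∣ n` one has `q ≡ 1`, `a_q ≡ 2 (mod I_n)`, so `P_q(X) = 1 − a_qX + qX² ≡ (1 − X)² ∈ A²_{q,I_n}`:
every `ρ_q`-factor is `0`, the derivative classes ARE transverse and (33) reads `κ′_n = κ_n` — which is
[K22] §2.3.2, last sentence (arXiv p. 12): "we do not need any modification of the image of
`D_{ℚ(μ_n)} z^{Kato}_{ℚ(μ_n)}` to obtain `κ̃^{Kato}_n` (cf. [MR04])", valid at every `p` including `3`
(App. A carries no (H.4)-type hypothesis).  Hence clause (0) at `q ∈ d` and clause (I4) (with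
`κ′ = κ` wherever (0) holds at `v₃`) are derivable from print; the ONLY non-print content of (0) is AT
`v₃` on SHALLOW vertices of `t ≥ 1` rows (flag `A2-shallow-vertex`, ROUTE-1 §24.2 (b), register
ADDENDUM 5).  [cite: MazurRubin2004, Thm. A.4 and Def. A.3 (p. 80)]
[cite: Kim2022StructureSelmer, §2.3.2 (arXiv p. 12, last sentence)]

**(R-a) ONE PORT, TWO SPELLINGS.**  n1011-p13's `KatoKuriharaDictionaryThreeOneAt W t D v₃`
(`GaloisImage/KolyvaginLevelOneUnitCaseOfDictionary.lean`, p271070; T-a5x, `E[3]`-literal: module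
`W.torsionGaloisModule 3`, structure `propagatedSelmerStructureOne W 3`, `ZMod 3`,
`kuriharaNumber P.f 3 …`) ≡ `KatoKuriharaDictionaryThreeAt W 0 t …` above — the `k = 0` reading with
the level-`3^0·3` objects spelt literally; SAME debt line DICT3, SAME flag `K22-Thm3.13-PORT@3`, no
second port.  (R-b) With `hP` pinning `D.primes` at Kolyvagin level `1` the predicate is the printed one
iff `t = 0`; at `t ≥ 1` use primes of level `≥ 1 + t` (ROUTE-1 §24.2 (b)).

**(R-d / D10 v2) Provenance of the class `κ` by row type** (r1 GEN 16, ROUTE-1 §28.2 (c) RULING —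
supersedes §26.2 (f) and rider R-d v1; n1011-lit `LIT-INPUTS-P3.md` v42 §51; a note for the PROVENANCE
column / doc flags ONLY: no binder, record, typed-`Prop` text or mark changes).  TOWER rows
(`ρ_{3^∞}` onto `⊇ SL₂(ℤ₃)` = (12.5.2)): Kato's `N`-primitive `z_γ` are integral in print (Thm. 12.5 (4)
+ 13.14) — the (a′) chain is untouched.  EXOTIC rows (surj(3), no `3`-adic tower; flag
`EXOTIC-Kato-integrality@3`, doc-only, inside the DICT3₁ debt line): CYCLOTOMIC direction — [Kato04]
Thm. 12.4 (3) + 12.6 + 13.12–13.14 under `E[3]` irreducible ([Wut14] Lemma 12) — print (Kato 12.4 (3),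
12.6, 13.12 carry no reduction-type or image hypothesis beyond `p ≠ 2`, `T/𝔪T` irreducible; 13.14
uses (12.5.2) only for freeness).  TAME direction — (i) on the recorded population (`[0]⁺` a `3`-adic
unit, `t = 0`, `r_an = 0` — the DICT3₁ consumer) IN PRINT with no port and no image hypothesis, via
Kato's `a(1)`-type `(c,d)`-Euler system (Astérisque 295, Ex. 13.3 with `ξ = 0(1)`, `(c, 18) = (d, 18N)
= 1`, `c ≡ d ≡ 2 (mod 3)`; values 9.7 + 6.6 (1); pp. 156, 163, 180, 186, 189, 222, 225), the unit
`u_d` of clause (DICT3) absorbing `cd(c−1)(d−1)·[0]⁺ ∈ 𝔽₃ˣ`; (ii) on any other EXOTIC row the optimal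
(`μ`-divided, `N`-primitive, Néron-normalised) classes are load-bearing and their tame integrality is
T. Kataoka, Math. Z. 298 (2021) Thm. 6.1 + Rem. 6.2 (2), read as a PORT at the additive prime (flag
`Kataoka21-Thm6.1-good@p`: printed under "good reduction at `p`", no step of the proof uses it; its
hypotheses `E[3]` irreducible and `E(ℚ(μ_{3n}))[3] = 0` hold on EXOTIC rows by surj(3) and
`E(ℚ^{ab})[3] = 0`, T-R18a).  CONSEQUENCES: the v1 sub-flags `/imprimitive-ok`, `/primitive-needed` and
the row filter `𝒰₃` are WITHDRAWN (R1-42′(a) cancelled; Q1/Q2′/Q3 closed); D10 is 'print / one named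
port', not a located unprinted input.  [cite: Kato2004Asterisque, Thm. 12.4 (3), 12.5 (4), 12.6, Ex. 13.3, 13.12, 13.14]

**(B1) Levels of `D` from the ℕ-currency** (lead R5-53 / r1 §25.4 (c) CONVENTION LEMMA): a register
or scan pair `n = ℓ₁ℓ₂` of Kolyvagin–`τ` primes (`3^m ∣ ℓᵢ − 1`, `3^m ∣ a_{ℓᵢ} − 2`, `Ẽ(𝔽_{ℓᵢ})[3]` cyclic)
IS a level `{v_{ℓ₁}, v_{ℓ₂}} ⊆ frobeniusClassPrimes (E[3^m]) S τ 3^m` of the typed datum: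
`GaloisImage/TransvectionNormalForm.lean` (p09, p272935: `p`-adic normal form), `TransvectionGaloisInputs`
(p09), `KolyvaginPrimeCyclicityTransfer` (p09: the records' `hcyc` currency forbids a Frobenius fixing
`E[3]`), `KolyvaginPrimeFrobeniusClass` (p18: the membership theorem) — the modulus `m` a free
parameter (r1 §27.3 (e)). -/

end Summit.BirchSwinnertonDyer.Rank1Residual.GaloisImage

end
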